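import Summits.ResolutionOfSingularities.ResolutionOfSingularities.Theses.PAlteration
import Summits.ResolutionOfSingularities.ResolutionOfSingularities.Theses.Valuative

/-!
# Cross-route edge: the cruxes of route `Valuative` imply the crux `Picover` of route `pAlteration`

Crux item `stmt-ResolutionOfSingularities-0554` (`PAlteration.Picover`). The deciding theorem of route
`Valuative` (`Valuative.closes : LuAlphaPTorsor → TorsorToLurel → PatchingRel → ResolutionOfSingularities`,
pure logic, in the Theses file) and faithfulness of `Picover` (the summit implies it: a finite cover of a
separated finite-type `k`-scheme is separated of finite type, an integral scheme is reduced) give the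
edge BY NAME: local uniformization of `α_p`-torsors + Temkin's inseparable reduction + Zariski patching
imply `Picover`. Recorded so that planners see the dependency between the two routes' cruxes (the
residue of the line `degree-p-tower` for `Picover` is the GLOBAL form of `LuAlphaPTorsor`).
-/

set_option linter.dupNamespace false -- mandated namespace of this single-conjunct summit

open CategoryTheory AlgebraicGeometry

namespace Summit.ResolutionOfSingularities.ResolutionOfSingularities.Theorems.Picover.OfValuative

/-- **Route `Valuative`'s cruxes imply `Picover`** (registered sub-goal `picover_of_valuative`):
`LuAlphaPTorsor → TorsorToLurel → PatchingRel → Picover`, through the summit statement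
(`Valuative.closes`) and the faithfulness of `Picover`. [folklore] -/
theorem picover_of_valuative : Summit.ResolutionOfSingularities.ResolutionOfSingularities.Theses.Valuative.LuAlphaPTorsor → Summit.ResolutionOfSingularities.ResolutionOfSingularities.Theses.Valuative.TorsorToLurel → Summit.ResolutionOfSingularities.ResolutionOfSingularities.Theses.Valuative.PatchingRel → Summit.ResolutionOfSingularities.ResolutionOfSingularities.Theses.PAlteration.Picover := by
  intro h₂ h₄ h₃ p hp k _ _ Y X f g hsep hlft hqc _hY _hYreg hX hfin _hui _hsurj
  have hsummit : _root_.ResolutionOfSingularities :=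
    Summit.ResolutionOfSingularities.ResolutionOfSingularities.Theses.Valuative.closes h₂ h₄ h₃
  have h1 : IsSeparated (g ≫ f) := inferInstance
  have h2 : LocallyOfFiniteType (g ≫ f) := inferInstance
  have h3 : QuasiCompact (g ≫ f) := inferInstance
  exact hsummit p hp k X (g ≫ f) h1 h2 h3 inferInstance

end Summit.ResolutionOfSingularities.ResolutionOfSingularities.Theorems.Picover.OfValuative
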